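import Literature.AlgebraicGeometry.HodgeTheory.RealSp4Blocks
import Literature.AlgebraicGeometry.Motives.HodgeLieSymplecticBlocksRankSix
import HarnessLib

/-!
# Hodge classes on abelian varieties with slots over `A`, when `End_Hdg(H¹(A)) ⊗ ℂ` is diagonalised by REAL characters with SIX-dimensional blocks carrying Hodge–Darboux bases with rational `θ`-classes, are generated by divisor classes — Hodge–Darboux bases of six-dimensional blocks, their symplectic classes, the Lie step and the assembly (Ribet 1983 Thm. 1 in relative dimension three; Murty 1984 §3; Hazama 1983/1989)

Family `hodge`, layer `Literature/AlgebraicGeometry/HodgeTheory`. Research context: cell `pub-hodge-ring2`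
(HONEST FRAMING: research route conditional on HC_CM; not a corollary; Q11.4-sentence-2 already refuted in
dim ≥ 3), Literature lane gen 82, programme R59 «Ribet 1983 in relative dimension three», the CYCLE SIDE. This file is
the rank-six twin of the tree's `RealMultiplicationRelDimTwoDivisorClasses` §1/§3, `RealSp4Blocks` §1 and
`RealCharactersSp4SlotsHodgeClasses` (four-dimensional blocks, Moonen–Zarhin 1995 Type I(2)), fed by the rank-six Lie
theorem `SpBlocksThetaSix.exists_mem_spanC_supported` of `HodgeLieSymplecticBlocksRankSix` (Ribet 1983 Thm. 1 for
`d/e = 3`: `Hg(A) = Res_{F/ℚ} Sp(W_0, ψ)`, `Hg(A, ℂ) ≃ ∏_σ Sp(U_σ, ψ_σ)` with `dim U_σ = 6`, Gordon's survey p. 18).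
THEOREMS ONLY (no definition, no named fact; D-0026); UNCONDITIONAL (the two `BettiUniverse` data hypotheses
`exists_isReal_hodgeModel`, `hodgePQ_independent_of_hodgeModel` are arguments, as everywhere in this layer); no step
towards a summit statement beyond the published theorems it re-assembles.

PUBLISHED STATEMENTS. Ribet 1983 Thm. 1 with Thm. 0 (Gordon 1997 Thms. 6.2–6.3, p. 18): `End⁰A = F` totally real,
`d/e` odd ⟹ `Hg(A) = Lf(A)` and `Hdg(Aⁿ) = Div(Aⁿ)`; the proof (Gordon p. 18): «`(∧*_ℚ((W^∨)ⁿ))^{Hg(A)} ⊗ ℂ ≃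
⊗_σ (∧*_ℂ (U_σ^∨)ⁿ)^{Sp(U_σ, ψ_σ)}` … this algebra of invariants is generated by its elements of degree 2». Murty 1984
§3 (Gordon §7.7): the factors `Sp(V_τ, ψ_τ)` of the Lefschetz group in their standard representation and
`H*(A^k, ℚ)^{Lf(A)} = Div(A^k)`; Milne 1999 Prop. 3.6 (a), p. 654: the degree-two invariants `φ_τ ∈ Λ² V_τ` are
divisor classes.

SETTING. `A` a complex abelian variety; `ψ` a polarization of `H = H¹(A(ℂ); ℚ)` for which `End_Hdg(H)` is self-adjoint;
`σ_τ` (`τ ∈ T`) characters of `End_Hdg(H)` with eigenblocks `V_τ`, `H ⊗ ℂ = ⊕_τ V_τ`, `dim V_τ = 6`. A HODGE–DARBOUX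
block basis is `b_τ : Fin 6 → V_τ` with `b_τ 0, b_τ 1, b_τ 2 ∈ H^{1,0}`, `b_τ 3, b_τ 4, b_τ 5 ∈ H^{0,1}` and Gram matrix
`ψ_ℂ(b_τ a, b_τ c) = G_{ac}`, `G = ( 0 I₃ ; -I₃ 0 )`; its symplectic class is
`θ_τ = ρ(b_τ 0) ⌣ ρ(b_τ 3) + ρ(b_τ 1) ⌣ ρ(b_τ 4) + ρ(b_τ 2) ⌣ ρ(b_τ 5) ∈ H²(A(ℂ); ℂ)`.

* §1 `HodgeStructure.exists_hodgeDarboux_blockBasis_six` — Hodge–Darboux bases of six-dimensional eigenblocks exist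
  (Deligne's construction `Milne1999.exists_adapted_symplecticBasis` with `J = Θ|_{V_τ}`; `2m = 6`).
* §2 the Gram matrix `G`: `gramSix_eq_neg_reindex_J` (`G = −J` in `Fin 3 ⊕ Fin 3 ≃ Fin 6`), `gramSix_mul_self`,
  `gramSix_inv` (`G⁻¹ = −G`), `gramSix_isAlt`, `gramSix_nondegenerate`.
* §3 `casimirClass_eq_sum_blocks_darboux_six_of_characters` (the `ψ`-Casimir class in Hodge–Darboux six-block
  coordinates) and **`thetaSix_mem_span_rational_oneOne_of_characters`**: `θ_τ ∈ B¹(A) ⊗ ℂ` (`2θ_τ = Λ(p_τ)`, `p_τ` the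
  block projector, an element of `End_Hdg ⊗ ℂ`).
* §4 `rm6Letters_cross_mem_span_rational_oneOne`, `sum_gramSixInv_smul_cup_rm6Letters_mem` — the hypothesis `hcross`
  of the several-blocks divisor criterion for the letters `g_j^* b_τ a`.
* §5 **`AVSlots.exists_sp6Invariant_coeff_of_real_characters`** — THE LIE STEP: every rational `(p,p)`-class on an
  abelian variety `B` with slots over `A` is `∑_w a(w)·(g b)_w` with slices killed by `𝔰𝔭(V_τ) ≅ 𝔰𝔭₆` at each place
  (through `SpBlocksThetaSix.exists_mem_spanC_supported`).
* §6 **`AVSlots.hodgeClasses_divisorial_of_sp6BlockBasis`**, **`AVSlots.isDivisorGenerated_of_sp6BlockBasis`** —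
  `B•(B) = D•(B) ⊗ ℂ` for every `B` with slots over such an `A` (coloured tensor FFT for `∏_τ Sp₆`).

## References

* [Ribet1983] K. A. Ribet, *Hodge classes on certain types of abelian varieties*, Amer. J. Math. 105 (1983), Thms. 0, 1.
  [cite: Ribet1983, Thm. 1]
* [Gordon1997] B. B. Gordon, *A survey of the Hodge conjecture for abelian varieties*, arXiv:alg-geom/9709030, Thms. 6.2–6.3
  and p. 18, §7.7. [cite: Gordon1997, Thm. 6.3 (arXiv:alg-geom/9709030 p. 18)]
* [Murty1984] V. K. Murty, *Exceptional Hodge classes on certain abelian varieties*, Math. Ann. 268 (1984), §3.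
  [cite: Murty1984, §3]
* [Milne1999LefschetzClasses] J. S. Milne, *Lefschetz classes on abelian varieties*, Duke Math. J. 96 (1999), Prop. 3.6,
  p. 654, p. 658. [cite: Milne1999LefschetzClasses, §3 Prop. 3.6 (a) and p. 654]
* [Hazama1983] F. Hazama, Tôhoku Math. J. 35 (1983), §3 pp. 305–306. [cite: Hazama1983, §3 (pp. 305–306)]
* [Hazama1989] F. Hazama, Duke Math. J. 58 (1989) 31–37. [cite: Hazama1989, Thm. (= Gordon 7.6.2)]
* [Deligne1982HodgeCycles] P. Deligne, LNM 900 (1982), I §3, §4. [cite: Deligne1982HodgeCycles, §4 proof of Cor. 4.2]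
* [GoodmanWallachGTM255] R. Goodman, N. R. Wallach, GTM 255 (2009), §2.1.2, §4.1.1. [cite: GoodmanWallachGTM255, §2.1.2]
-/

noncomputable section

open scoped TensorProduct Matrix
open CategoryTheory Module NumberField

/-! ### §1 Hodge–Darboux bases of six-dimensional eigenblocks (abstract Hodge structures) -/

namespace Literature.AlgebraicGeometry.Motives

namespace HodgeStructure

section DarbouxSix

universe u

/-- `finSumFinEquiv.symm` on the six elements of `Fin 6`. [folklore] -/
private theorem fsf6_0 : finSumFinEquiv.symm (0 : Fin 6) = (Sum.inl 0 : Fin 3 ⊕ Fin 3) := by decide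
/-- [folklore] -/
private theorem fsf6_1 : finSumFinEquiv.symm (1 : Fin 6) = (Sum.inl 1 : Fin 3 ⊕ Fin 3) := by decide
/-- [folklore] -/
private theorem fsf6_2 : finSumFinEquiv.symm (2 : Fin 6) = (Sum.inl 2 : Fin 3 ⊕ Fin 3) := by decide
/-- [folklore] -/
private theorem fsf6_3 : finSumFinEquiv.symm (3 : Fin 6) = (Sum.inr 0 : Fin 3 ⊕ Fin 3) := by decide
/-- [folklore] -/
private theorem fsf6_4 : finSumFinEquiv.symm (4 : Fin 6) = (Sum.inr 1 : Fin 3 ⊕ Fin 3) := by decide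
/-- [folklore] -/
private theorem fsf6_5 : finSumFinEquiv.symm (5 : Fin 6) = (Sum.inr 2 : Fin 3 ⊕ Fin 3) := by decide

variable {V : Type u} [AddCommGroup V] [Module ℚ V] [Module.Finite ℚ V] [HodgeTensorFacts.{u, u}] {n : ℤ}
variable {ι : Type*} [DecidableEq ι]

/-- **Hodge–Darboux bases of six-dimensional eigenblocks.** Let `H` be an effective polarized weight-one `ℚ`-Hodge
structure such that every Hodge endomorphism is `ψ`-self-adjoint, and `σ_i` characters of `End_Hdg` whose eigenblocks
`T_i` form an internal direct sum and are six-dimensional. Then every `T_i` has a basis `b_i : Fin 6 → T_i` with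
`b_i 0, b_i 1, b_i 2 ∈ V^{1,0}`, `b_i 3, b_i 4, b_i 5 ∈ V^{0,1}` and Gram matrix `ψ_ℂ(b_i a, b_i c) = G_{ac}`,
`G = ( 0 I₃ ; -I₃ 0 )`. Proof: `ψ_ℂ|_{T_i}` is alternating and non-degenerate, `J = Θ|_{T_i}` satisfies `J² = 1`,
`ψ_ℂ(Jx, Jy) = -ψ_ℂ(x, y)`, so Deligne's construction (`Milne1999.exists_adapted_symplecticBasis`: the eigenspaces
`T_i ∩ V^{1,0}`, `T_i ∩ V^{0,1}` are transverse Lagrangians in duality) gives a symplectic basis of eigenvectors; `2m = 6`.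
The tree's `exists_hodgeDarboux_blockBasis_four` with `4 ↦ 6`. [cite: Deligne1982HodgeCycles, §4 proof of Cor. 4.2]
[cite: Milne1999LefschetzClasses, §3 Prop. 3.6 (c) and p. 658] -/
theorem exists_hodgeDarboux_blockBasis_six (H : HodgeStructure V n) (hn : n = 1) (heff : H.IsEffective)
    (ψ : H.Polarization)
    (hself : ∀ a : H.endAlg, LinearMap.IsAdjointPair ψ.form ψ.form (a : Module.End ℚ V) (a : Module.End ℚ V))
    (σ : ι → (H.endAlg →+* ℂ)) (hint : DirectSum.IsInternal fun i => H.eigenBlock (σ i))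
    (h6 : ∀ i, Module.finrank ℂ (H.eigenBlock (σ i)) = 6) :
    ∃ b : ∀ i, Module.Basis (Fin 6) ℂ (H.eigenBlock (σ i)),
      (∀ i (r : Fin 6), (r : ℕ) < 3 → (b i r : ℂ ⊗[ℚ] V) ∈ H.piece 1 0) ∧
      (∀ i (r : Fin 6), 3 ≤ (r : ℕ) → (b i r : ℂ ⊗[ℚ] V) ∈ H.piece 0 1) ∧
      (∀ i (a c : Fin 6), ψ.form.baseChange ℂ (b i a : ℂ ⊗[ℚ] V) (b i c) =
        (!![0, 0, 0, 1, 0, 0; 0, 0, 0, 0, 1, 0; 0, 0, 0, 0, 0, 1; -1, 0, 0, 0, 0, 0; 0, -1, 0, 0, 0, 0;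
          0, 0, -1, 0, 0, 0] : Matrix (Fin 6) (Fin 6) ℂ) a c) := by
  classical
  subst hn
  obtain ⟨Θ, hΘ⟩ := exists_hodgeTheta H
  obtain ⟨hP, hQ, -, -, hΘΘ⟩ := UnitaryTheta.theta_facts H rfl heff hΘ
  have hΘC : Θ ∈ H.hodgeLieC := H.mem_hodgeLieC_of_forall_piece hΘ
  have hodd : Odd (1 : ℤ) := ⟨0, by norm_num⟩
  -- eigenvectors of `Θ` lie in the Hodge pieces
  have hplus : ∀ v : ℂ ⊗[ℚ] V, Θ v = v → v ∈ H.piece 1 0 := fun v hv => by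
    have h := hP v
    rwa [hv, ← two_smul ℂ v, smul_smul, inv_mul_cancel₀ (two_ne_zero' ℂ), one_smul] at h
  have hminus : ∀ v : ℂ ⊗[ℚ] V, Θ v = -v → v ∈ H.piece 0 1 := fun v hv => by
    have h := hQ v
    rwa [hv, sub_neg_eq_add, ← two_smul ℂ v, smul_smul, inv_mul_cancel₀ (two_ne_zero' ℂ), one_smul] at h
  have key : ∀ i, ∃ b : Module.Basis (Fin 6) ℂ (H.eigenBlock (σ i)),
      (∀ r : Fin 6, (r : ℕ) < 3 → (b r : ℂ ⊗[ℚ] V) ∈ H.piece 1 0) ∧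
      (∀ r : Fin 6, 3 ≤ (r : ℕ) → (b r : ℂ ⊗[ℚ] V) ∈ H.piece 0 1) ∧
      (∀ a c : Fin 6, ψ.form.baseChange ℂ (b a : ℂ ⊗[ℚ] V) (b c) =
        (!![0, 0, 0, 1, 0, 0; 0, 0, 0, 0, 1, 0; 0, 0, 0, 0, 0, 1; -1, 0, 0, 0, 0, 0; 0, -1, 0, 0, 0, 0;
          0, 0, -1, 0, 0, 0] : Matrix (Fin 6) (Fin 6) ℂ) a c) := by
    intro i
    set T := H.eigenBlock (σ i) with hT
    haveI : FiniteDimensional ℂ T := Module.finite_of_finrank_eq_succ (h6 i)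
    have hΘT : ∀ x ∈ T, Θ x ∈ T := fun x hx => H.apply_mem_eigenBlock_of_mem_hodgeLieC hΘC hx
    -- the restricted form and the restricted Hodge operator
    set B : LinearMap.BilinForm ℂ T := (ψ.form.baseChange ℂ).compl₁₂ T.subtype T.subtype with hB
    have hBapply : ∀ x y : T, B x y = ψ.form.baseChange ℂ (x : ℂ ⊗[ℚ] V) (y : ℂ ⊗[ℚ] V) := fun x y => rfl
    set J : Module.End ℂ T := Θ.restrict hΘT with hJ
    have hJapply : ∀ x : T, ((J x : T) : ℂ ⊗[ℚ] V) = Θ x := fun x => rfl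
    have hBalt : B.IsAlt := fun x => by
      change B x x = 0
      rw [hBapply]
      exact form_baseChange_self_eq_zero_of_odd H hodd ψ _
    have hleft : B.SeparatingLeft := fun x hx =>
      Subtype.ext (SymplecticBlocks.eq_zero_of_forall_block H ψ hself σ hint i x.2 fun y hy => by
        have h := hx ⟨y, hy⟩
        rwa [hBapply] at h)
    have hBnd : B.Nondegenerate := by
      refine ⟨hleft, fun y hy => hleft y fun x => ?_⟩
      rw [hBapply, form_baseChange_swap_of_odd H hodd ψ, ← hBapply, hy x, neg_zero]
    have hJJ : ∀ x, J (J x) = ((1 : ℂ) ^ 2) • x := fun x => Subtype.ext (by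
      rw [one_pow, one_smul, hJapply, hJapply, hΘΘ])
    have hJB : ∀ x y, B (J x) (J y) = -((1 : ℂ) ^ 2) * B x y := fun x y => by
      rw [hBapply, hBapply, hJapply, hJapply, formBaseChange_skew_of_mem_hodgeLieC ψ hΘC, hΘΘ]
      ring
    obtain ⟨m, b₁, hll, hrr, hlr, hJl, hJr⟩ :=
      Literature.AlgebraicGeometry.Milne1999.exists_adapted_symplecticBasis B hBalt hBnd J one_ne_zero hJJ hJB
    -- `m = 3`
    have hm : m = 3 := by
      have h := Module.finrank_eq_card_basis b₁
      rw [h6 i, Fintype.card_sum, Fintype.card_fin] at h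
      omega
    subst hm
    -- eigenvectors and pairings in terms of `ψ_ℂ`
    have hinl : ∀ j, ((b₁ (Sum.inl j) : T) : ℂ ⊗[ℚ] V) ∈ H.piece 1 0 := fun j => hplus _ (by
      rw [← hJapply, hJl, one_smul])
    have hinr : ∀ j, ((b₁ (Sum.inr j) : T) : ℂ ⊗[ℚ] V) ∈ H.piece 0 1 := fun j => hminus _ (by
      rw [← hJapply, hJr, neg_one_smul, Submodule.coe_neg])
    have pll : ∀ j j', ψ.form.baseChange ℂ ((b₁ (Sum.inl j) : T) : ℂ ⊗[ℚ] V) (b₁ (Sum.inl j') : T) = 0 :=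
      fun j j' => by rw [← hBapply, hll]
    have prr : ∀ j j', ψ.form.baseChange ℂ ((b₁ (Sum.inr j) : T) : ℂ ⊗[ℚ] V) (b₁ (Sum.inr j') : T) = 0 :=
      fun j j' => by rw [← hBapply, hrr]
    have plr : ∀ j j', ψ.form.baseChange ℂ ((b₁ (Sum.inl j) : T) : ℂ ⊗[ℚ] V) (b₁ (Sum.inr j') : T) =
        if j = j' then 1 else 0 := fun j j' => by rw [← hBapply, hlr]
    have prl : ∀ j j', ψ.form.baseChange ℂ ((b₁ (Sum.inr j) : T) : ℂ ⊗[ℚ] V) (b₁ (Sum.inl j') : T) =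
        -(if j' = j then 1 else 0) := fun j j' => by
      rw [form_baseChange_swap_of_odd H hodd ψ, ← hBapply, hlr]
    -- reindex to `Fin 6`
    refine ⟨b₁.reindex finSumFinEquiv, fun r hr => ?_, fun r hr => ?_, fun a c => ?_⟩
    · fin_cases r <;>
        simp only [Module.Basis.reindex_apply, Fin.zero_eta, Fin.isValue, Fin.mk_one, Fin.reduceFinMk, fsf6_0,
          fsf6_1, fsf6_2, fsf6_3, fsf6_4, fsf6_5]
      · exact hinl 0
      · exact hinl 1
      · exact hinl 2
      · exact absurd hr (by decide)
      · exact absurd hr (by decide)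
      · exact absurd hr (by decide)
    · fin_cases r <;>
        simp only [Module.Basis.reindex_apply, Fin.zero_eta, Fin.isValue, Fin.mk_one, Fin.reduceFinMk, fsf6_0,
          fsf6_1, fsf6_2, fsf6_3, fsf6_4, fsf6_5]
      · exact absurd hr (by decide)
      · exact absurd hr (by decide)
      · exact absurd hr (by decide)
      · exact hinr 0
      · exact hinr 1
      · exact hinr 2
    · rw [Module.Basis.reindex_apply, Module.Basis.reindex_apply]
      fin_cases a <;> fin_cases c <;>
        simp [fsf6_0, fsf6_1, fsf6_2, fsf6_3, fsf6_4, fsf6_5, pll, prr, plr, prl]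
  choose b hbP hbQ hgram using key
  exact ⟨b, hbP, hbQ, hgram⟩

end DarbouxSix

end HodgeStructure

end Literature.AlgebraicGeometry.Motives

namespace Literature.AlgebraicGeometry.HodgeTheory

open Literature.AlgebraicTopology.SingularHomology
open Literature.AlgebraicGeometry.Motives (IsSmoothProjective AbelianVariety bettiCohomology
  ofRatClassBaseChange ofRatClassBaseChange_tmul HodgeTensorFacts hodgeTensorFacts_holds)
open Literature.Barriers.HodgeConjecture
open Literature.AlgebraicGeometry.Motives.HodgeStructure
open Literature.AlgebraicGeometry.ComplexMultiplication
open Literature.RepresentationTheory.GeneralLinear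
open Literature.RepresentationTheory.ClassicalInvariants
open Literature.NumberTheory.DiophantineGeometry

/-! ### §2 The Gram matrix `G = ( 0 I₃ ; -I₃ 0 )` of a Hodge–Darboux six-block basis -/

/-- `G = −J` with `J = Matrix.J (Fin 3) ℂ` transported along `Fin 3 ⊕ Fin 3 ≃ Fin 6`. [cite: GoodmanWallachGTM255, §2.1.2] -/
theorem gramSix_eq_neg_reindex_J :
    (!![0, 0, 0, 1, 0, 0; 0, 0, 0, 0, 1, 0; 0, 0, 0, 0, 0, 1; -1, 0, 0, 0, 0, 0; 0, -1, 0, 0, 0, 0;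
        0, 0, -1, 0, 0, 0] : Matrix (Fin 6) (Fin 6) ℂ) =
      -Matrix.reindex finSumFinEquiv finSumFinEquiv (Matrix.J (Fin 3) ℂ) := by
  ext i j
  fin_cases i <;> fin_cases j <;>
    simp only [Matrix.neg_apply, Matrix.reindex_apply, Matrix.submatrix_apply, Fin.zero_eta, Fin.isValue,
      Fin.mk_one, Fin.reduceFinMk, fsf6_0, fsf6_1, fsf6_2, fsf6_3, fsf6_4, fsf6_5, Matrix.J,
      Matrix.fromBlocks_apply₁₁, Matrix.fromBlocks_apply₁₂, Matrix.fromBlocks_apply₂₁, Matrix.fromBlocks_apply₂₂] <;>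
    simp

/-- `G² = −1`. [cite: GoodmanWallachGTM255, §2.1.2] -/
theorem gramSix_mul_self :
    (!![0, 0, 0, 1, 0, 0; 0, 0, 0, 0, 1, 0; 0, 0, 0, 0, 0, 1; -1, 0, 0, 0, 0, 0; 0, -1, 0, 0, 0, 0;
        0, 0, -1, 0, 0, 0] : Matrix (Fin 6) (Fin 6) ℂ) *
      !![0, 0, 0, 1, 0, 0; 0, 0, 0, 0, 1, 0; 0, 0, 0, 0, 0, 1; -1, 0, 0, 0, 0, 0; 0, -1, 0, 0, 0, 0;
        0, 0, -1, 0, 0, 0] = -1 := by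
  ext i j
  fin_cases i <;> fin_cases j <;>
    simp [Matrix.mul_apply, Fin.sum_univ_six]

/-- **`G⁻¹ = −G`.** [cite: GoodmanWallachGTM255, §2.1.2] -/
theorem gramSix_inv :
    (!![0, 0, 0, 1, 0, 0; 0, 0, 0, 0, 1, 0; 0, 0, 0, 0, 0, 1; -1, 0, 0, 0, 0, 0; 0, -1, 0, 0, 0, 0;
        0, 0, -1, 0, 0, 0] : Matrix (Fin 6) (Fin 6) ℂ)⁻¹ =
      -!![0, 0, 0, 1, 0, 0; 0, 0, 0, 0, 1, 0; 0, 0, 0, 0, 0, 1; -1, 0, 0, 0, 0, 0; 0, -1, 0, 0, 0, 0;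
        0, 0, -1, 0, 0, 0] := by
  refine Matrix.inv_eq_left_inv ?_
  rw [Matrix.neg_mul, gramSix_mul_self, neg_neg]

/-- `G` is alternating. [cite: GoodmanWallachGTM255, §2.1.2] -/
theorem gramSix_isAlt :
    (Matrix.toBilin' (!![0, 0, 0, 1, 0, 0; 0, 0, 0, 0, 1, 0; 0, 0, 0, 0, 0, 1; -1, 0, 0, 0, 0, 0;
      0, -1, 0, 0, 0, 0; 0, 0, -1, 0, 0, 0] : Matrix (Fin 6) (Fin 6) ℂ)).IsAlt := by
  intro x
  rw [Matrix.toBilin'_apply']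
  simp [Matrix.mulVec, dotProduct, Fin.sum_univ_six]
  ring

/-- `G` is non-degenerate. [cite: GoodmanWallachGTM255, §2.1.2] -/
theorem gramSix_nondegenerate :
    (Matrix.toBilin' (!![0, 0, 0, 1, 0, 0; 0, 0, 0, 0, 1, 0; 0, 0, 0, 0, 0, 1; -1, 0, 0, 0, 0, 0;
      0, -1, 0, 0, 0, 0; 0, 0, -1, 0, 0, 0] : Matrix (Fin 6) (Fin 6) ℂ)).Nondegenerate := by
  rw [LinearMap.BilinForm.nondegenerate_toBilin'_iff_det_ne_zero]
  intro h0
  have h1 := congrArg Matrix.det gramSix_mul_self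
  rw [Matrix.det_mul, h0, zero_mul, Matrix.det_neg, Matrix.det_one, Fintype.card_fin] at h1
  norm_num at h1


/-! ### §3 The `ψ`-Casimir class in Hodge–Darboux six-block coordinates; `θ_τ ∈ B¹(A) ⊗ ℂ` -/

section Characters

variable {A : AbelianVariety ℂ}

/-- **The Casimir class in Hodge–Darboux six-block coordinates** (Gram matrix `( 0 I₃ ; -I₃ 0 )`):
`Λ(Y) = ∑_τ ∑_{j<3} [ρ(Y b_τ j) ⌣ ρ(b_τ (j+3)) − ρ(Y b_τ (j+3)) ⌣ ρ(b_τ j)]` (the blockwise dual family is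
`(-b_τ3, -b_τ4, -b_τ5, b_τ0, b_τ1, b_τ2)`; `casimirClass_eq_sum_dualFamily_of_characters`). The tree's
`casimirClass_eq_sum_blocks_darboux_of_characters` with `4 ↦ 6`. [cite: Hazama1983, §3 (p. 305)]
[cite: GoodmanWallachGTM255, §4.1.1] [cite: Milne1999LefschetzClasses, p. 654] -/
theorem casimirClass_eq_sum_blocks_darboux_six_of_characters (hHD : exists_isReal_hodgeModel)
    (ψ : (BettiUniverse.hodge hHD (AbelianVariety.isSmoothProjective_holds (A := A)) 1).Polarization)
    (hself : ∀ a : (BettiUniverse.hodge hHD (AbelianVariety.isSmoothProjective_holds (A := A)) 1).endAlg,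
      LinearMap.IsAdjointPair ψ.form ψ.form (a : Module.End ℚ (bettiCohomology A.X 1))
        (a : Module.End ℚ (bettiCohomology A.X 1)))
    {T : Type} [Fintype T] [DecidableEq T]
    (σ : T → ((BettiUniverse.hodge hHD (AbelianVariety.isSmoothProjective_holds (A := A)) 1).endAlg →+* ℂ))
    (hσ : Function.Injective σ)
    (hint : DirectSum.IsInternal fun τ =>
      (BettiUniverse.hodge hHD (AbelianVariety.isSmoothProjective_holds (A := A)) 1).eigenBlock (σ τ))
    (b : ∀ τ : T, Module.Basis (Fin 6) ℂ
      ((BettiUniverse.hodge hHD (AbelianVariety.isSmoothProjective_holds (A := A)) 1).eigenBlock (σ τ)))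
    (hgram : ∀ τ (a c : Fin 6), ψ.form.baseChange ℂ (b τ a : ℂ ⊗[ℚ] bettiCohomology A.X 1) (b τ c) =
      (!![0, 0, 0, 1, 0, 0; 0, 0, 0, 0, 1, 0; 0, 0, 0, 0, 0, 1; -1, 0, 0, 0, 0, 0; 0, -1, 0, 0, 0, 0;
        0, 0, -1, 0, 0, 0] : Matrix (Fin 6) (Fin 6) ℂ) a c)
    {ι : Type*} [Fintype ι] [DecidableEq ι] (e : Module.Basis ι ℚ (bettiCohomology A.X 1))
    (Y : Module.End ℂ (ℂ ⊗[ℚ] bettiCohomology A.X 1)) :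
    casimirClass A ψ.form ψ.nondegenerate e Y =
      ∑ τ, (cupH1 A (Y (b τ 0)) (b τ 3) - cupH1 A (Y (b τ 3)) (b τ 0) +
        (cupH1 A (Y (b τ 1)) (b τ 4) - cupH1 A (Y (b τ 4)) (b τ 1)) +
        (cupH1 A (Y (b τ 2)) (b τ 5) - cupH1 A (Y (b τ 5)) (b τ 2))) := by
  classical
  -- the blockwise dual family
  set d : T × Fin 6 → ℂ ⊗[ℚ] bettiCohomology A.X 1 := fun τa =>
    ![-(b τa.1 3 : ℂ ⊗[ℚ] bettiCohomology A.X 1), -(b τa.1 4 : ℂ ⊗[ℚ] bettiCohomology A.X 1),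
      -(b τa.1 5 : ℂ ⊗[ℚ] bettiCohomology A.X 1), (b τa.1 0 : ℂ ⊗[ℚ] bettiCohomology A.X 1),
      (b τa.1 1 : ℂ ⊗[ℚ] bettiCohomology A.X 1), (b τa.1 2 : ℂ ⊗[ℚ] bettiCohomology A.X 1)] τa.2 with hd
  have hd0 : ∀ τ, d (τ, 0) = -(b τ 3 : ℂ ⊗[ℚ] bettiCohomology A.X 1) := fun τ => rfl
  have hd1 : ∀ τ, d (τ, 1) = -(b τ 4 : ℂ ⊗[ℚ] bettiCohomology A.X 1) := fun τ => rfl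
  have hd2 : ∀ τ, d (τ, 2) = -(b τ 5 : ℂ ⊗[ℚ] bettiCohomology A.X 1) := fun τ => rfl
  have hd3 : ∀ τ, d (τ, 3) = (b τ 0 : ℂ ⊗[ℚ] bettiCohomology A.X 1) := fun τ => rfl
  have hd4 : ∀ τ, d (τ, 4) = (b τ 1 : ℂ ⊗[ℚ] bettiCohomology A.X 1) := fun τ => rfl
  have hd5 : ∀ τ, d (τ, 5) = (b τ 2 : ℂ ⊗[ℚ] bettiCohomology A.X 1) := fun τ => rfl
  have hdT : ∀ τ a, d (τ, a) ∈ (BettiUniverse.hodge hHD AbelianVariety.isSmoothProjective_holds 1).eigenBlock (σ τ) := by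
    intro τ a
    fin_cases a
    · exact Submodule.neg_mem _ (b τ 3).2
    · exact Submodule.neg_mem _ (b τ 4).2
    · exact Submodule.neg_mem _ (b τ 5).2
    · exact (b τ 0).2
    · exact (b τ 1).2
    · exact (b τ 2).2
  have hdual : ∀ τ (a c : Fin 6), ψ.form.baseChange ℂ (d (τ, a)) (b τ c : ℂ ⊗[ℚ] bettiCohomology A.X 1) =
      if a = c then 1 else 0 := by
    intro τ a c
    fin_cases a <;> fin_cases c <;>
      simp only [Fin.zero_eta, Fin.isValue, Fin.mk_one, Fin.reduceFinMk, hd0, hd1, hd2, hd3, hd4, hd5, map_neg,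
        LinearMap.neg_apply, hgram] <;>
      simp
  rw [casimirClass_eq_sum_dualFamily_of_characters hHD ψ hself σ hσ hint b d hdT hdual e Y]
  refine Finset.sum_congr rfl fun τ _ => ?_
  rw [Fin.sum_univ_six, hd0, hd1, hd2, hd3, hd4, hd5]
  simp only [map_neg, LinearMap.neg_apply]
  abel

/-- **Theorem (`θ_τ = ρ(b_τ 0) ⌣ ρ(b_τ 3) + ρ(b_τ 1) ⌣ ρ(b_τ 4) + ρ(b_τ 2) ⌣ ρ(b_τ 5) ∈ B¹(A) ⊗ ℂ`; Murty 1984 §3 /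
Milne 1999 Prop. 3.6 (a), p. 654: the symplectic form `ω_τ ∈ Λ² V_τ` of each factor is a divisor class).** For a
polarization `ψ` of `H¹(A(ℂ); ℚ)` with `End_Hdg` self-adjoint, an injective family of characters `σ` with six-dimensional
eigenblocks and Hodge–Darboux block bases `b_τ`, the class `θ_τ` is a `ℂ`-combination of RATIONAL `(1,1)`-classes:
`2 θ_τ = Λ(p_τ) ∈ span_ℂ {Λ(a ⊗ 1) : a ∈ End_Hdg}` (`p_τ` the block projector, `blockScalar_mem_span_endAlg_of_characters`),
each `Λ(a ⊗ 1)` rational (`isRationalClass_casimirClass_baseChange`) and of type `(1,1)` (§3: `a` is the scalar `σ_τ(a)`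
on `V_τ` and the kinds of `(b_τ j, b_τ (j+3))` are `(1,0), (0,1)`). The tree's
`thetaFour_mem_span_rational_oneOne_of_characters` with `4 ↦ 6`. [cite: Murty1984, §3]
[cite: Milne1999LefschetzClasses, §3 Prop. 3.6 (a) and p. 654] [cite: Ribet1983, Thm. 0] [cite: Hazama1983, §3 (pp. 305–306)] -/
theorem thetaSix_mem_span_rational_oneOne_of_characters [HodgeTensorFacts.{0, 0}] (hHD : exists_isReal_hodgeModel)
    (hI : hodgePQ_independent_of_hodgeModel)
    (ψ : (BettiUniverse.hodge hHD (AbelianVariety.isSmoothProjective_holds (A := A)) 1).Polarization)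
    (hself : ∀ a : (BettiUniverse.hodge hHD (AbelianVariety.isSmoothProjective_holds (A := A)) 1).endAlg,
      LinearMap.IsAdjointPair ψ.form ψ.form (a : Module.End ℚ (bettiCohomology A.X 1))
        (a : Module.End ℚ (bettiCohomology A.X 1)))
    {T : Type} [Fintype T] [DecidableEq T]
    (σ : T → ((BettiUniverse.hodge hHD (AbelianVariety.isSmoothProjective_holds (A := A)) 1).endAlg →+* ℂ))
    (hσ : Function.Injective σ)
    (hint : DirectSum.IsInternal fun τ =>
      (BettiUniverse.hodge hHD (AbelianVariety.isSmoothProjective_holds (A := A)) 1).eigenBlock (σ τ))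
    (b : ∀ τ : T, Module.Basis (Fin 6) ℂ
      ((BettiUniverse.hodge hHD (AbelianVariety.isSmoothProjective_holds (A := A)) 1).eigenBlock (σ τ)))
    (hbP : ∀ τ (r : Fin 6), (r : ℕ) < 3 → (b τ r : ℂ ⊗[ℚ] bettiCohomology A.X 1) ∈
      (BettiUniverse.hodge hHD (AbelianVariety.isSmoothProjective_holds (A := A)) 1).piece 1 0)
    (hbQ : ∀ τ (r : Fin 6), 3 ≤ (r : ℕ) → (b τ r : ℂ ⊗[ℚ] bettiCohomology A.X 1) ∈
      (BettiUniverse.hodge hHD (AbelianVariety.isSmoothProjective_holds (A := A)) 1).piece 0 1)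
    (hgram : ∀ τ (a c : Fin 6), ψ.form.baseChange ℂ (b τ a : ℂ ⊗[ℚ] bettiCohomology A.X 1) (b τ c) =
      (!![0, 0, 0, 1, 0, 0; 0, 0, 0, 0, 1, 0; 0, 0, 0, 0, 0, 1; -1, 0, 0, 0, 0, 0; 0, -1, 0, 0, 0, 0;
        0, 0, -1, 0, 0, 0] : Matrix (Fin 6) (Fin 6) ℂ) a c)
    (τ : T) :
    cupH1 A (b τ 0 : ℂ ⊗[ℚ] bettiCohomology A.X 1) (b τ 3) + cupH1 A (b τ 1 : ℂ ⊗[ℚ] bettiCohomology A.X 1) (b τ 4) +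
        cupH1 A (b τ 2 : ℂ ⊗[ℚ] bettiCohomology A.X 1) (b τ 5) ∈
      Submodule.span ℂ {c : complexBetti A.X 2 | IsRationalClass c ∧ IsOfHodgeType A.dim A.X 2 1 1 c} := by
  classical
  have hX : IsSmoothProjective A.dim A.X := AbelianVariety.isSmoothProjective_holds
  haveI : Module.Finite ℚ (bettiCohomology A.X 1) := finite_bettiCohomology_one A
  set e := Module.finBasis ℚ (bettiCohomology A.X 1) with he
  set Λ := casimirClass A ψ.form ψ.nondegenerate e with hΛ
  set S := Submodule.span ℂ
    {c : complexBetti A.X 2 | IsRationalClass c ∧ IsOfHodgeType A.dim A.X 2 1 1 c} with hS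
  have hb0 : (b τ 0 : ℂ ⊗[ℚ] bettiCohomology A.X 1) ∈ (BettiUniverse.hodge hHD hX 1).piece 1 0 := hbP τ 0 (by decide)
  -- Hodge types of the block letters and of their cup products
  have ht10 : ∀ (x : ℂ ⊗[ℚ] bettiCohomology A.X 1), x ∈ (BettiUniverse.hodge hHD hX 1).piece 1 0 →
      IsOfHodgeType A.dim A.X 1 1 0 (ofRatClassBaseChange (Motives.ComplexPoints A.X) 1 x) :=
    fun x hx => (BettiUniverse.mem_hodge_piece_iff hHD hI hX (k := 1) (p := 1) (q := 0) rfl _).1 hx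
  have ht01 : ∀ (x : ℂ ⊗[ℚ] bettiCohomology A.X 1), x ∈ (BettiUniverse.hodge hHD hX 1).piece 0 1 →
      IsOfHodgeType A.dim A.X 1 0 1 (ofRatClassBaseChange (Motives.ComplexPoints A.X) 1 x) :=
    fun x hx => (BettiUniverse.mem_hodge_piece_iff hHD hI hX (k := 1) (p := 0) (q := 1) rfl _).1 hx
  have hcup := BettiUniverse.cupPreservesHodgeType hHD hI hX
  have hPQ : ∀ (x y : ℂ ⊗[ℚ] bettiCohomology A.X 1), x ∈ (BettiUniverse.hodge hHD hX 1).piece 1 0 →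
      y ∈ (BettiUniverse.hodge hHD hX 1).piece 0 1 → IsOfHodgeType A.dim A.X 2 1 1 (cupH1 A x y) := by
    intro x y hx hy
    have h : IsOfHodgeType A.dim A.X 2 (1 + 0) (0 + 1) _ := hcup (rfl : 1 + 1 = 2) (ht10 x hx) (ht01 y hy)
    rw [cupH1_apply]
    exact h
  have hQP : ∀ (x y : ℂ ⊗[ℚ] bettiCohomology A.X 1), x ∈ (BettiUniverse.hodge hHD hX 1).piece 0 1 →
      y ∈ (BettiUniverse.hodge hHD hX 1).piece 1 0 → IsOfHodgeType A.dim A.X 2 1 1 (cupH1 A x y) := by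
    intro x y hx hy
    have h : IsOfHodgeType A.dim A.X 2 (0 + 1) (1 + 0) _ := hcup (rfl : 1 + 1 = 2) (ht01 x hx) (ht10 y hy)
    rw [cupH1_apply]
    exact h
  have hP' : ∀ τ', (b τ' 0 : ℂ ⊗[ℚ] bettiCohomology A.X 1) ∈ (BettiUniverse.hodge hHD hX 1).piece 1 0 ∧
      (b τ' 1 : ℂ ⊗[ℚ] bettiCohomology A.X 1) ∈ (BettiUniverse.hodge hHD hX 1).piece 1 0 ∧
      (b τ' 2 : ℂ ⊗[ℚ] bettiCohomology A.X 1) ∈ (BettiUniverse.hodge hHD hX 1).piece 1 0 :=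
    fun τ' => ⟨hbP τ' 0 (by decide), hbP τ' 1 (by decide), hbP τ' 2 (by decide)⟩
  have hQ' : ∀ τ', (b τ' 3 : ℂ ⊗[ℚ] bettiCohomology A.X 1) ∈ (BettiUniverse.hodge hHD hX 1).piece 0 1 ∧
      (b τ' 4 : ℂ ⊗[ℚ] bettiCohomology A.X 1) ∈ (BettiUniverse.hodge hHD hX 1).piece 0 1 ∧
      (b τ' 5 : ℂ ⊗[ℚ] bettiCohomology A.X 1) ∈ (BettiUniverse.hodge hHD hX 1).piece 0 1 :=
    fun τ' => ⟨hbQ τ' 3 (by decide), hbQ τ' 4 (by decide), hbQ τ' 5 (by decide)⟩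
  -- (1) `Λ(a ⊗ 1) ∈ S` for `a ∈ End_Hdg`
  have hΛa : ∀ a : (BettiUniverse.hodge hHD hX 1).endAlg,
      Λ ((a : Module.End ℚ (bettiCohomology A.X 1)).baseChange ℂ) ∈ S := by
    intro a
    refine Submodule.subset_span ⟨isRationalClass_casimirClass_baseChange ψ.form ψ.nondegenerate e _, ?_⟩
    rw [hΛ, casimirClass_eq_sum_blocks_darboux_six_of_characters hHD ψ hself σ hσ hint b hgram e]
    obtain ⟨M⟩ := nonempty_hodgeModel_holds hX
    refine IsOfHodgeType.sum hX M _ _ fun τ' _ => ?_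
    obtain ⟨h0, h1, h2⟩ := hP' τ'
    obtain ⟨h3, h4, h5⟩ := hQ' τ'
    have ha : ∀ r, (a : Module.End ℚ (bettiCohomology A.X 1)).baseChange ℂ
        (b τ' r : ℂ ⊗[ℚ] bettiCohomology A.X 1) = σ τ' a • (b τ' r : _) :=
      fun r => ((BettiUniverse.hodge hHD hX 1).mem_eigenBlock_iff _ _).1 (b τ' r).2 a
    simp only [ha, map_smul, LinearMap.smul_apply]
    exact IsOfHodgeType.add hX (IsOfHodgeType.add hX
      (IsOfHodgeType.sub hX ((hPQ _ _ h0 h3).smul _) ((hQP _ _ h3 h0).smul _))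
      (IsOfHodgeType.sub hX ((hPQ _ _ h1 h4).smul _) ((hQP _ _ h4 h1).smul _)))
      (IsOfHodgeType.sub hX ((hPQ _ _ h2 h5).smul _) ((hQP _ _ h5 h2).smul _))
  -- (2) the block projector `P_τ ∈ End_Hdg ⊗ ℂ`, so `Λ(P_τ) ∈ S`
  obtain ⟨P, hPb⟩ := exists_blockProjector_of_characters hHD σ hint b τ
  have hΛP : Λ P ∈ S := by
    have hPmem := blockScalar_mem_span_endAlg_of_characters hHD σ hint b (fun τ' => if τ' = τ then (1 : ℂ) else 0) hPb
    have hle : Submodule.span ℂ ((fun a : Module.End ℚ (bettiCohomology A.X 1) => a.baseChange ℂ) ''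
        ((BettiUniverse.hodge hHD hX 1).endAlg : Set (Module.End ℚ (bettiCohomology A.X 1)))) ≤ S.comap Λ := by
      refine Submodule.span_le.2 ?_
      rintro _ ⟨a, ha, rfl⟩
      exact hΛa ⟨a, ha⟩
    exact hle hPmem
  -- (3) `Λ(P_τ) = 2 θ_τ`
  have hPb' : ∀ τ' (r : Fin 6), P (b τ' r : ℂ ⊗[ℚ] bettiCohomology A.X 1) =
      (if τ' = τ then (1 : ℂ) else 0) • (b τ' r : _) := fun τ' r => hPb τ' _ (b τ' r).2
  have hgc : ∀ x y : ℂ ⊗[ℚ] bettiCohomology A.X 1, cupH1 A y x = -cupH1 A x y := fun x y => by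
    rw [cupH1_apply, cupH1_apply, cupProduct_gradedComm_holds ℂ (Motives.ComplexPoints A.X)
      (rfl : 1 + 1 = 2) (rfl : 1 + 1 = 2)]
    norm_num
  have hΛPeq : Λ P = (2 : ℂ) • (cupH1 A (b τ 0 : ℂ ⊗[ℚ] bettiCohomology A.X 1) (b τ 3) +
      cupH1 A (b τ 1 : ℂ ⊗[ℚ] bettiCohomology A.X 1) (b τ 4) +
      cupH1 A (b τ 2 : ℂ ⊗[ℚ] bettiCohomology A.X 1) (b τ 5)) := by
    rw [hΛ, casimirClass_eq_sum_blocks_darboux_six_of_characters hHD ψ hself σ hσ hint b hgram e,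
      Finset.sum_eq_single τ]
    · rw [hPb', hPb', hPb', hPb', hPb', hPb', if_pos rfl, one_smul, one_smul, one_smul, one_smul, one_smul, one_smul]
      rw [hgc (b τ 0 : ℂ ⊗[ℚ] bettiCohomology A.X 1) (b τ 3), hgc (b τ 1 : ℂ ⊗[ℚ] bettiCohomology A.X 1) (b τ 4),
        hgc (b τ 2 : ℂ ⊗[ℚ] bettiCohomology A.X 1) (b τ 5), sub_neg_eq_add, sub_neg_eq_add, sub_neg_eq_add, two_smul]
      abel
    · intro τ' _ hτ'
      simp only [hPb', if_neg hτ', zero_smul, map_zero, LinearMap.zero_apply, sub_self, add_zero]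
    · intro h; exact absurd (Finset.mem_univ τ) h
  have h := S.smul_mem (2 : ℂ)⁻¹ hΛP
  rwa [hΛPeq, smul_smul, inv_mul_cancel₀ (two_ne_zero' ℂ), one_smul] at h

end Characters

/-! ### §4 Crossed classes of two slots at the same place; the hypothesis `hcross` of the several-blocks criterion -/

section Cross

variable {A B : AbelianVariety ℂ} {n : ℕ}

/-- **The crossed class of two slots AT THE SAME PLACE lies in `D¹(B) ⊗ ℂ`** (six-dimensional blocks): with
`x r = g_j^* ρ(b_τ r)`, `y r = g_{j'}^* ρ(b_τ r)`,
`∑_{k<3} (x_k ⌣ y_{k+3} + y_k ⌣ x_{k+3}) = (g_j + g_{j'})^* θ_τ − g_j^* θ_τ − g_{j'}^* θ_τ`, `θ_τ ∈ B¹(A) ⊗ ℂ`; pull-backs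
are additive on `H¹`, multiplicative, and preserve rational `(1,1)`-classes. The tree's
`rm4Letters_cross_mem_span_rational_oneOne` with `4 ↦ 6`. [cite: Gordon1997, §3 (proof of the Theorem)]
[cite: Murty1984, §3] -/
theorem rm6Letters_cross_mem_span_rational_oneOne (g : Fin n → (B ⟶ A)) {T : Type*}
    {W : T → Submodule ℂ (ℂ ⊗[ℚ] bettiCohomology A.X 1)} (b : ∀ τ, Module.Basis (Fin 6) ℂ (W τ))
    (hθ : ∀ τ, cupH1 A (b τ 0 : ℂ ⊗[ℚ] bettiCohomology A.X 1) (b τ 3) +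
        cupH1 A (b τ 1 : ℂ ⊗[ℚ] bettiCohomology A.X 1) (b τ 4) +
        cupH1 A (b τ 2 : ℂ ⊗[ℚ] bettiCohomology A.X 1) (b τ 5) ∈
      Submodule.span ℂ {c : complexBetti A.X 2 | IsRationalClass c ∧ IsOfHodgeType A.dim A.X 2 1 1 c})
    (j j' : Fin n) (τ : T) :
    let L : Fin n × T → Fin 6 → complexBetti B.X 1 := fun s a => complexBetti.map (g s.1).hom.hom.hom 1
      (ofRatClassBaseChange (Motives.ComplexPoints A.X) 1 (b s.2 a : ℂ ⊗[ℚ] bettiCohomology A.X 1))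
    cupProduct (rfl : 1 + 1 = 2) (L (j, τ) 0) (L (j', τ) 3) + cupProduct (rfl : 1 + 1 = 2) (L (j', τ) 0) (L (j, τ) 3) +
        (cupProduct (rfl : 1 + 1 = 2) (L (j, τ) 1) (L (j', τ) 4) +
          cupProduct (rfl : 1 + 1 = 2) (L (j', τ) 1) (L (j, τ) 4)) +
        (cupProduct (rfl : 1 + 1 = 2) (L (j, τ) 2) (L (j', τ) 5) +
          cupProduct (rfl : 1 + 1 = 2) (L (j', τ) 2) (L (j, τ) 5)) ∈
      Submodule.span ℂ {c : complexBetti B.X 2 | IsRationalClass c ∧ IsOfHodgeType B.dim B.X 2 1 1 c} := by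
  intro L
  have hB : IsSmoothProjective B.dim B.X := Motives.AbelianVariety.isSmoothProjective_holds
  have hA : IsSmoothProjective A.dim A.X := Motives.AbelianVariety.isSmoothProjective_holds
  set f : Fin 6 → complexBetti A.X 1 := fun r =>
    ofRatClassBaseChange (Motives.ComplexPoints A.X) 1 (b τ r : ℂ ⊗[ℚ] bettiCohomology A.X 1) with hf
  set θ : complexBetti A.X 2 := cupProduct (rfl : 1 + 1 = 2) (f 0) (f 3) + cupProduct (rfl : 1 + 1 = 2) (f 1) (f 4) +
    cupProduct (rfl : 1 + 1 = 2) (f 2) (f 5) with hθdef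
  have hθ' : θ ∈ Submodule.span ℂ
      {c : complexBetti A.X 2 | IsRationalClass c ∧ IsOfHodgeType A.dim A.X 2 1 1 c} := by
    have h := hθ τ
    rwa [cupH1_apply, cupH1_apply, cupH1_apply] at h
  have hpull : ∀ φ : B ⟶ A, complexBetti.map φ.hom.hom.hom 2 θ =
      cupProduct (rfl : 1 + 1 = 2) (complexBetti.map φ.hom.hom.hom 1 (f 0)) (complexBetti.map φ.hom.hom.hom 1 (f 3)) +
        cupProduct (rfl : 1 + 1 = 2) (complexBetti.map φ.hom.hom.hom 1 (f 1))
          (complexBetti.map φ.hom.hom.hom 1 (f 4)) +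
        cupProduct (rfl : 1 + 1 = 2) (complexBetti.map φ.hom.hom.hom 1 (f 2))
          (complexBetti.map φ.hom.hom.hom 1 (f 5)) := fun φ => by
    rw [hθdef, map_add, map_add, complexBetti.map_cupProduct, complexBetti.map_cupProduct, complexBetti.map_cupProduct]
  have hLj : ∀ a : Fin 6, L (j, τ) a = complexBetti.map (g j).hom.hom.hom 1 (f a) := fun a => rfl
  have hLj' : ∀ a : Fin 6, L (j', τ) a = complexBetti.map (g j').hom.hom.hom 1 (f a) := fun a => rfl
  have key : cupProduct (rfl : 1 + 1 = 2) (L (j, τ) 0) (L (j', τ) 3) +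
        cupProduct (rfl : 1 + 1 = 2) (L (j', τ) 0) (L (j, τ) 3) +
        (cupProduct (rfl : 1 + 1 = 2) (L (j, τ) 1) (L (j', τ) 4) +
          cupProduct (rfl : 1 + 1 = 2) (L (j', τ) 1) (L (j, τ) 4)) +
        (cupProduct (rfl : 1 + 1 = 2) (L (j, τ) 2) (L (j', τ) 5) +
          cupProduct (rfl : 1 + 1 = 2) (L (j', τ) 2) (L (j, τ) 5)) =
      complexBetti.map (g j + g j').hom.hom.hom 2 θ - complexBetti.map (g j).hom.hom.hom 2 θ -
        complexBetti.map (g j').hom.hom.hom 2 θ := by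
    have hadd : ∀ v : complexBetti A.X 1, complexBetti.map (g j + g j').hom.hom.hom 1 v =
        complexBetti.map (g j).hom.hom.hom 1 v + complexBetti.map (g j').hom.hom.hom 1 v :=
      fun v => complexBetti_map_add_deg_one (g j) (g j') v
    simp only [hLj, hLj', hpull, hadd, map_add, LinearMap.add_apply]
    abel
  rw [key]
  exact Submodule.sub_mem _ (Submodule.sub_mem _ (map_mem_span_rational_oneOne hB hA _ hθ')
    (map_mem_span_rational_oneOne hB hA _ hθ')) (map_mem_span_rational_oneOne hB hA _ hθ')

/-- **The hypothesis `hcross` of the several-blocks divisor criterion for the letters `g_j^* b_τ a`** (six-dimensional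
blocks): for two slots `s = (j, τ)`, `s' = (j', τ)` at the same place,
`∑_{a,a'} (G⁻¹)_{a a'} · g_j^* ρ(b_τ a) ⌣ g_{j'}^* ρ(b_τ a') = −(crossed class) ∈ D¹(B) ⊗ ℂ` (`G⁻¹ = -G` pairs
kind `{0,1,2}` with kind `{3,4,5}`; anticommutativity of the cup product in degree one). The tree's
`sum_gramFourInv_smul_cup_rm4Letters_mem` with `4 ↦ 6`. [cite: Milne1999LefschetzClasses, §3 Prop. 3.6 (a) and p. 656]
[cite: Murty1984, §3] -/
theorem sum_gramSixInv_smul_cup_rm6Letters_mem (g : Fin n → (B ⟶ A)) {T : Type*}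
    {W : T → Submodule ℂ (ℂ ⊗[ℚ] bettiCohomology A.X 1)} (b : ∀ τ, Module.Basis (Fin 6) ℂ (W τ))
    (hθ : ∀ τ, cupH1 A (b τ 0 : ℂ ⊗[ℚ] bettiCohomology A.X 1) (b τ 3) +
        cupH1 A (b τ 1 : ℂ ⊗[ℚ] bettiCohomology A.X 1) (b τ 4) +
        cupH1 A (b τ 2 : ℂ ⊗[ℚ] bettiCohomology A.X 1) (b τ 5) ∈
      Submodule.span ℂ {c : complexBetti A.X 2 | IsRationalClass c ∧ IsOfHodgeType A.dim A.X 2 1 1 c})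
    (s s' : Fin n × T) (hss' : s.2 = s'.2) :
    (∑ a : Fin 6, ∑ a' : Fin 6,
        (!![0, 0, 0, 1, 0, 0; 0, 0, 0, 0, 1, 0; 0, 0, 0, 0, 0, 1; -1, 0, 0, 0, 0, 0; 0, -1, 0, 0, 0, 0;
            0, 0, -1, 0, 0, 0] : Matrix (Fin 6) (Fin 6) ℂ)⁻¹ a a' •
          cupProduct (rfl : 1 + 1 = 2)
            (complexBetti.map (g s.1).hom.hom.hom 1
              (ofRatClassBaseChange (Motives.ComplexPoints A.X) 1 (b s.2 a : ℂ ⊗[ℚ] bettiCohomology A.X 1)))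
            (complexBetti.map (g s'.1).hom.hom.hom 1
              (ofRatClassBaseChange (Motives.ComplexPoints A.X) 1 (b s'.2 a' : ℂ ⊗[ℚ] bettiCohomology A.X 1)))) ∈
      Submodule.span ℂ {c : complexBetti B.X 2 | IsRationalClass c ∧ IsOfHodgeType B.dim B.X 2 1 1 c} := by
  obtain ⟨j, τ⟩ := s
  obtain ⟨j', τ'⟩ := s'
  dsimp only at hss'
  subst hss'
  set L : Fin n × T → Fin 6 → complexBetti B.X 1 := fun s a => complexBetti.map (g s.1).hom.hom.hom 1
    (ofRatClassBaseChange (Motives.ComplexPoints A.X) 1 (b s.2 a : ℂ ⊗[ℚ] bettiCohomology A.X 1)) with hLdef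
  have hcross := rm6Letters_cross_mem_span_rational_oneOne g b hθ j j' τ
  change cupProduct (rfl : 1 + 1 = 2) (L (j, τ) 0) (L (j', τ) 3) + cupProduct (rfl : 1 + 1 = 2) (L (j', τ) 0) (L (j, τ) 3) +
      (cupProduct (rfl : 1 + 1 = 2) (L (j, τ) 1) (L (j', τ) 4) +
        cupProduct (rfl : 1 + 1 = 2) (L (j', τ) 1) (L (j, τ) 4)) +
      (cupProduct (rfl : 1 + 1 = 2) (L (j, τ) 2) (L (j', τ) 5) +
        cupProduct (rfl : 1 + 1 = 2) (L (j', τ) 2) (L (j, τ) 5)) ∈ _ at hcross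
  change (∑ a : Fin 6, ∑ a' : Fin 6, (!![0, 0, 0, 1, 0, 0; 0, 0, 0, 0, 1, 0; 0, 0, 0, 0, 0, 1; -1, 0, 0, 0, 0, 0;
      0, -1, 0, 0, 0, 0; 0, 0, -1, 0, 0, 0] :
      Matrix (Fin 6) (Fin 6) ℂ)⁻¹ a a' • cupProduct (rfl : 1 + 1 = 2) (L (j, τ) a) (L (j', τ) a')) ∈ _
  have hgc : ∀ x y : complexBetti B.X 1, cupProduct (rfl : 1 + 1 = 2) y x = -cupProduct (rfl : 1 + 1 = 2) x y :=
    fun x y => by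
    rw [cupProduct_gradedComm_holds ℂ (Motives.ComplexPoints B.X) (rfl : 1 + 1 = 2) (rfl : 1 + 1 = 2)]
    norm_num
  rw [gramSix_inv]
  simp only [Fin.sum_univ_six, Matrix.neg_apply, Matrix.of_apply, Matrix.cons_val', Matrix.cons_val_zero,
    Matrix.cons_val_one, Matrix.cons_val, Matrix.empty_val', Matrix.cons_val_fin_one, neg_zero, zero_smul,
    add_zero, zero_add, neg_smul, one_smul, neg_neg]
  convert Submodule.neg_mem _ hcross using 1
  rw [hgc (L (j', τ) 0) (L (j, τ) 3), hgc (L (j', τ) 1) (L (j, τ) 4), hgc (L (j', τ) 2) (L (j, τ) 5)]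
  abel

end Cross

/-! ### §5 The Lie step: the invariance theorem for a family of real characters with six-dimensional blocks -/

section Invariance

variable {A B : AbelianVariety ℂ} {n : ℕ} {g : Fin n → (B ⟶ A)}

/-- The two elements of `Fin 2`. [folklore] -/
private theorem fin2_eq_zero_or_one' (r : Fin 2) : r = 0 ∨ r = 1 := by
  fin_cases r <;> simp

open scoped Classical in
/-- **The INVARIANCE THEOREM for a family of real characters with six-dimensional blocks (Ribet 1983 Thm. 1 in
relative dimension three / Murty 1984 §3 / Hazama, Lie step, for abelian varieties with slots over `A`).** Let `A` be a
complex abelian variety, `ψ` a polarization of `H¹(A(ℂ); ℚ)` for which `End_Hdg(H¹)` is self-adjoint, `σ_τ` (`τ ∈ T`) REAL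
characters of `End_Hdg(H¹(A))` whose eigenblocks `V_τ` give `H¹(A) ⊗ ℂ = ⊕_τ V_τ` with `dim V_τ = 6`, `b_τ` bases of the
`V_τ` adapted to the Hodge decomposition through the kind map `kd`, and `B` an abelian variety with slots `g` over `A`.
Then every rational class `c` of type `(p,p)` on `B` (`p ≥ 1`) is `∑_w a(w) · (g b)_w` for a coefficient function `a`
such that for every slot-and-place word `U`, every place `τ` and every `ψ_ℂ|_{V_τ}`-skew endomorphism `f` of `V_τ`
(`f ∈ 𝔰𝔭(V_τ) ≅ 𝔰𝔭₆`), the matrix of `f` in `b_τ` placed at the positions of place `τ` kills the slice `a(U, −)` («the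
`i`-th component acts on `V_i ⊕ ⋯ ⊕ V_i` diagonally», Hazama p. 306; «`Hg(A, ℂ) ≃ ∏_σ Sp(U_σ, ψ_σ)`», Gordon p. 18).
The proof is that of the tree's `AVSlots.exists_sp4Invariant_coeff_of_real_characters` with the rank-six Goursat theorem
`SpBlocksThetaSix.exists_mem_spanC_supported` (admissible Lie algebras on six-dimensional real blocks are `⊕_τ 𝔰𝔭(V_τ)`
after complexification). [cite: Ribet1983, Thm. 1] [cite: Gordon1997, Thm. 6.3 (arXiv:alg-geom/9709030 p. 18)]
[cite: Murty1984, §3] [cite: Hazama1983, §3 (pp. 305–306)] [cite: Deligne1982HodgeCycles, I §3 (proof of Prop. 3.4)] -/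
theorem AVSlots.exists_sp6Invariant_coeff_of_real_characters [HodgeTensorFacts.{0, 0}] (hg : AVSlots A B g)
    (hHD : exists_isReal_hodgeModel) (hI : hodgePQ_independent_of_hodgeModel)
    {T : Type} [Fintype T] [DecidableEq T]
    (ψ : (BettiUniverse.hodge hHD (AbelianVariety.isSmoothProjective_holds (A := A)) 1).Polarization)
    (hself : ∀ a : (BettiUniverse.hodge hHD (AbelianVariety.isSmoothProjective_holds (A := A)) 1).endAlg,
      LinearMap.IsAdjointPair ψ.form ψ.form (a : Module.End ℚ (bettiCohomology A.X 1))
        (a : Module.End ℚ (bettiCohomology A.X 1)))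
    (σ : T → ((BettiUniverse.hodge hHD (AbelianVariety.isSmoothProjective_holds (A := A)) 1).endAlg →+* ℂ))
    (hreal : ∀ τ, (starRingEnd ℂ).comp (σ τ) = σ τ)
    (hint : DirectSum.IsInternal fun τ =>
      (BettiUniverse.hodge hHD (AbelianVariety.isSmoothProjective_holds (A := A)) 1).eigenBlock (σ τ))
    (h6 : ∀ τ, Module.finrank ℂ
      ((BettiUniverse.hodge hHD (AbelianVariety.isSmoothProjective_holds (A := A)) 1).eigenBlock (σ τ)) = 6)
    (b : ∀ τ : T, Module.Basis (Fin 6) ℂ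
      ((BettiUniverse.hodge hHD (AbelianVariety.isSmoothProjective_holds (A := A)) 1).eigenBlock
        (σ τ)))
    (kd : Fin 6 → Fin 2)
    (hb0 : ∀ τ r, kd r = 0 → (b τ r : ℂ ⊗[ℚ] bettiCohomology A.X 1) ∈
      (BettiUniverse.hodge hHD (AbelianVariety.isSmoothProjective_holds (A := A)) 1).piece 1 0)
    (hb1 : ∀ τ r, kd r = 1 → (b τ r : ℂ ⊗[ℚ] bettiCohomology A.X 1) ∈
      (BettiUniverse.hodge hHD (AbelianVariety.isSmoothProjective_holds (A := A)) 1).piece 0 1)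
    {p : ℕ} (hp : 0 < p) {c : complexBetti B.X (2 * p)} (hcQ : IsRationalClass c)
    (hc : IsOfHodgeType B.dim B.X (2 * p) p p c) :
    ∃ a : (Fin (2 * p) → (Fin n × T) × Fin 6) → ℂ,
      wordEval (cupPowOneAlt ℂ (Motives.ComplexPoints B.X) (2 * p))
        (fun jr : (Fin n × T) × Fin 6 => complexBetti.map (g jr.1.1).hom.hom.hom 1
          (ofRatClassBaseChange (Motives.ComplexPoints A.X) 1
            (b jr.1.2 jr.2 : ℂ ⊗[ℚ] bettiCohomology A.X 1))) a = c ∧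
      ∀ (U : Fin (2 * p) → Fin n × T) (τ : T)
        (f : Module.End ℂ ↥((BettiUniverse.hodge hHD (AbelianVariety.isSmoothProjective_holds (A := A)) 1).eigenBlock
          (σ τ))),
        (∀ x y : (BettiUniverse.hodge hHD (AbelianVariety.isSmoothProjective_holds (A := A)) 1).eigenBlock
            (σ τ),
          ψ.form.baseChange ℂ ((f x : _) : ℂ ⊗[ℚ] bettiCohomology A.X 1) y +
            ψ.form.baseChange ℂ (x : ℂ ⊗[ℚ] bettiCohomology A.X 1) ((f y : _) : ℂ ⊗[ℚ] bettiCohomology A.X 1) = 0) →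
        wordDerAt ℂ (fun t => if (U t).2 = τ then LinearMap.toMatrix (b τ) (b τ) f else 0)
          (wordSlice a U) = 0 := by
  classical
  -- the setting
  have hX : IsSmoothProjective A.dim A.X := AbelianVariety.isSmoothProjective_holds
  haveI : Module.Finite ℚ (bettiCohomology A.X 1) := finite_bettiCohomology_one A
  have heff : (BettiUniverse.hodge hHD hX 1).IsEffective := BettiUniverse.hodge_isEffective hHD hX 1
  set F := cupPowOneAlt ℂ (Motives.ComplexPoints B.X) (2 * p) with hFdef
  have hFinj : Function.Injective (exteriorPower.alternatingMapLinearEquiv F) :=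
    injective_alternatingMapLinearEquiv_cupPowOneAlt B (2 * p)
  -- bases: the block basis `cbσ` and the rational basis `eC`, both indexed by `Fin M`
  set cbx : Module.Basis (T × Fin 6) ℂ (ℂ ⊗[ℚ] bettiCohomology A.X 1) :=
    (hint.collectedBasis b).reindex (Equiv.sigmaEquivProd T (Fin 6)) with hcbxdef
  set eQ := Module.finBasis ℚ (bettiCohomology A.X 1) with heQ
  set eC : Module.Basis (Fin (Module.finrank ℚ (bettiCohomology A.X 1))) ℂ
    (ℂ ⊗[ℚ] bettiCohomology A.X 1) := Algebra.TensorProduct.basis ℂ eQ with heC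
  set φ : Fin (Module.finrank ℚ (bettiCohomology A.X 1)) ≃ T × Fin 6 :=
    eC.indexEquiv cbx with hφ
  set cbσ : Module.Basis (Fin (Module.finrank ℚ (bettiCohomology A.X 1))) ℂ
    (ℂ ⊗[ℚ] bettiCohomology A.X 1) := cbx.reindex φ.symm with hcbσdef
  have hcbx : ∀ τr : T × Fin 6,
      (cbx τr : ℂ ⊗[ℚ] bettiCohomology A.X 1) = b τr.1 τr.2 := by
    intro τr
    rw [hcbxdef, Module.Basis.reindex_apply, DirectSum.IsInternal.collectedBasis_coe]
    rfl
  have hcbσ : ∀ m, (cbσ m : ℂ ⊗[ℚ] bettiCohomology A.X 1) = b (φ m).1 (φ m).2 := fun m => by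
    rw [hcbσdef, Module.Basis.reindex_apply, Equiv.symm_symm, hcbx]
  -- letters
  set ρ := ofRatClassBaseChangeEquiv hX 1 with hρ
  set v : Module.Basis _ ℂ (complexBetti A.X 1) := cbσ.map ρ with hv
  set eL : Module.Basis _ ℂ (complexBetti A.X 1) := eC.map ρ with heL
  have heLQ : ∀ i, IsRationalClass (eL i) := fun i => by
    rw [heL, Module.Basis.map_apply, heC, Algebra.TensorProduct.basis_apply, hρ,
      ofRatClassBaseChangeEquiv_apply, ofRatClassBaseChange_tmul, one_smul]
    exact isRationalClass_ofRatClass _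
  set κ : Fin (Module.finrank ℚ (bettiCohomology A.X 1)) → Fin 2 := fun m => kd (φ m).2 with hκ
  have hv_apply : ∀ m, v m = ofRatClassBaseChange (Motives.ComplexPoints A.X) 1
      (b (φ m).1 (φ m).2 : ℂ ⊗[ℚ] bettiCohomology A.X 1) := fun m => by
    rw [hv, Module.Basis.map_apply, hcbσ, hρ, ofRatClassBaseChangeEquiv_apply]
  have hv0 : ∀ m, κ m = 0 → IsOfHodgeType A.dim A.X 1 1 0 (v m) := by
    intro m hm
    rw [hv_apply, ← BettiUniverse.mem_hodge_piece_iff hHD hI hX (k := 1) (p := 1) (q := 0) rfl]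
    exact hb0 (φ m).1 (φ m).2 hm
  have hv1 : ∀ m, κ m = 1 → IsOfHodgeType A.dim A.X 1 0 1 (v m) := by
    intro m hm
    rw [hv_apply, ← BettiUniverse.mem_hodge_piece_iff hHD hI hX (k := 1) (p := 0) (q := 1) rfl]
    exact hb1 (φ m).1 (φ m).2 hm
  -- (α) an antisymmetric kind-balanced coefficient function in the adapted letters
  obtain ⟨ax, hax_bal, hax_anti, hcax⟩ := hg.exists_antisymm_kindBalanced_wordEval_eq v κ hv0 hv1 hp hc
  -- the change of letters to the rational letters
  set G : Matrix _ _ ℂ := eC.toMatrix cbσ with hG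
  set G' : Matrix _ _ ℂ := cbσ.toMatrix eC with hG'
  have hG'G : G' * G = 1 := cbσ.toMatrix_mul_toMatrix_flip eC
  have hve : ∀ m, v m = ∑ i, G i m • eL i := fun m => by
    simp only [hv, heL, Module.Basis.map_apply, ← map_smul, ← map_sum]
    congr 1
    exact (eC.sum_toMatrix_smul_self (v := ⇑cbσ) (j := m)).symm
  have hletters : ∀ j m, avLetters g v (j, m) = ∑ i, G i m • avLetters g eL (j, i) :=
    avLetters_baseChange g G hve
  set aE := colourChangeAt (fun _ : Fin n => G) ax with haE
  have haE_anti : IsAntisymm aE := hax_anti.colourChangeAt _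
  have hcaE : wordEval F (avLetters g eL) aE = c := by
    rw [haE, ← wordEval_eq_wordEval_colourChangeAt F (fun _ : Fin n => G) hletters ax, hcax]
  -- rationality of `aE`
  obtain ⟨q, hq⟩ := hg.exists_rat_wordEval_eq eL heLQ hcQ
  obtain ⟨q', -, haEq⟩ := haE_anti.exists_eq_algebraMap_of_wordEval_eq hFinj (hg.letterBasis eL)
    (q := q) (by rw [AVSlots.coe_letterBasis, hcaE, hFdef, hq])
  have hslice_e : ∀ u, wordSlice aE u = wordRepAt ℂ (fun _ : Fin (2 * p) => G) (wordSlice ax u) :=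
    fun u => wordSlice_colourChangeAt (fun _ : Fin n => G) ax u
  -- the Hodge operator `Θ`: `diag(±1)` in the adapted letters
  obtain ⟨Θ, hΘ⟩ := exists_hodgeTheta (BettiUniverse.hodge hHD hX 1)
  have hΘb : ∀ m, Θ (cbσ m) = (if κ m = 0 then (1 : ℂ) else -1) • cbσ m := by
    intro m
    rcases fin2_eq_zero_or_one' (κ m) with h0 | h1
    · rw [if_pos h0, hcbσ]
      have hmem : (b (φ m).1 (φ m).2 : ℂ ⊗[ℚ] bettiCohomology A.X 1) ∈
          (BettiUniverse.hodge hHD hX 1).piece 1 (((1 : ℕ) : ℤ) - 1) := by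
        have e : (((1 : ℕ) : ℤ) - 1) = 0 := by norm_num
        rw [e]; exact hb0 _ _ h0
      rw [hΘ 1 _ hmem]
      norm_num
    · rw [if_neg (by rw [h1]; exact one_ne_zero), hcbσ]
      have hmem : (b (φ m).1 (φ m).2 : ℂ ⊗[ℚ] bettiCohomology A.X 1) ∈
          (BettiUniverse.hodge hHD hX 1).piece 0 (((1 : ℕ) : ℤ) - 0) := by
        have e : (((1 : ℕ) : ℤ) - 0) = 1 := by norm_num
        rw [e]; exact hb1 _ _ h1
      rw [hΘ 0 _ hmem]
      norm_num
  have hΘcb : LinearMap.toMatrix cbσ cbσ Θ = kindDiag κ := by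
    ext i m
    rw [LinearMap.toMatrix_apply, hΘb, map_smul, Module.Basis.repr_self, Finsupp.smul_apply,
      Finsupp.single_apply, kindDiag, Matrix.diagonal_apply, smul_eq_mul, mul_ite, mul_one, mul_zero]
    by_cases him : i = m
    · subst him; rw [if_pos rfl]
    · rw [if_neg (Ne.symm him), if_neg him]
  have hJG : LinearMap.toMatrix eC eC Θ * G = G * kindDiag κ := by
    rw [← hΘcb, hG, linearMap_toMatrix_mul_basis_toMatrix, basis_toMatrix_mul_linearMap_toMatrix]
  have hΘq : ∀ u : Fin (2 * p) → Fin n, wordDerAt ℂ (fun _ : Fin (2 * p) => LinearMap.toMatrix eC eC Θ)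
      (wordSlice (fun w => algebraMap ℚ ℂ (q' w)) u) = 0 := by
    intro u
    rw [← haEq, hslice_e]
    refine wordDerAt_wordRepAt_eq_zero_of_mul_eq ℂ (fun _ : Fin (2 * p) => G) (fun _ => hJG) ?_
    rw [wordDerAt_const]
    exact wordDer_kindDiag_wordSlice_eq_zero κ hax_bal u
  -- the rational Lie algebra `𝔞 ⊆ 𝔰𝔭_F(H¹, ψ)` of the rational tensor `q'`; `Θ ∈ 𝔞_ℂ`
  set 𝔞 : Submodule ℚ (Module.End ℚ (bettiCohomology A.X 1)) := annLie ψ.form eQ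
    (fun a' : (BettiUniverse.hodge hHD hX 1).endAlg => (a' : Module.End ℚ (bettiCohomology A.X 1))) q'
    with h𝔞
  have hΘC : Θ ∈ (BettiUniverse.hodge hHD hX 1).hodgeLieC :=
    (BettiUniverse.hodge hHD hX 1).mem_hodgeLieC_of_forall_piece hΘ
  have hΘ𝔞 : Θ ∈ spanC 𝔞 :=
    mem_spanC_annLie ψ.form eQ _ q' hΘq
      (fun a' => commute_baseChange_of_mem_hodgeLieC (BettiUniverse.hodge hHD hX 1) hΘC a')
      fun x y => by rw [formBaseChange_skew_of_mem_hodgeLieC ψ hΘC, neg_add_cancel]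
  have hbr : ∀ X ∈ 𝔞, ∀ X' ∈ 𝔞, X * X' - X' * X ∈ 𝔞 := fun X hX' X' hX'' =>
    commutator_mem_annLie ψ.form eQ _ q' hX' hX''
  have hcomm : ∀ X ∈ 𝔞, ∀ a' : (BettiUniverse.hodge hHD hX 1).endAlg,
      X * (a' : Module.End ℚ (bettiCohomology A.X 1)) = (a' : Module.End ℚ (bettiCohomology A.X 1)) * X :=
    fun X hX' a' => ((mem_annLie_iff ψ.form eQ _ q' X).1 hX').2.1 a'
  have hskew : ∀ X ∈ 𝔞, ∀ v' w, ψ.form (X v') w + ψ.form v' (X w) = 0 :=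
    fun X hX' => ((mem_annLie_iff ψ.form eQ _ q' X).1 hX').2.2
  -- the coefficient function, refined to slot-and-place colours
  refine ⟨fun w => ax fun t => ((w t).1.1, φ.symm ((w t).1.2, (w t).2)), ?_, fun U τ f hf => ?_⟩
  · rw [← hcax]
    have hx : (fun jr : (Fin n × T) × Fin 6 =>
        avLetters g v (jr.1.1, φ.symm (jr.1.2, jr.2))) =
        fun jr : (Fin n × T) × Fin 6 => complexBetti.map (g jr.1.1).hom.hom.hom 1
          (ofRatClassBaseChange (Motives.ComplexPoints A.X) 1
            (b jr.1.2 jr.2 : ℂ ⊗[ℚ] bettiCohomology A.X 1)) := by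
      funext jr
      rw [avLetters_apply, hv_apply, Equiv.apply_symm_apply]
    rw [← hx]
    exact wordEval_blockLetters F φ (avLetters g v) ax
  · -- an element `Y ∈ 𝔞_ℂ` equal to `f` on `V_τ` and to `0` on the other blocks
    obtain ⟨Y, hY, hYf, hY0⟩ := SpBlocksThetaSix.exists_mem_spanC_supported (BettiUniverse.hodge hHD hX 1)
      Nat.cast_one heff ψ hself σ hreal hint h6 𝔞 hbr hΘ hΘ𝔞 hcomm hskew τ f hf
    have hL : ∀ u : Fin (2 * p) → Fin n, wordDerAt ℂ (fun _ : Fin (2 * p) => LinearMap.toMatrix eC eC Y)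
        (wordSlice (fun w => algebraMap ℚ ℂ (q' w)) u) = 0 := fun u => by
      rw [h𝔞] at hY
      exact wordDerAt_eq_zero_of_mem_spanC_annLie ψ.form eQ _ q' hY u
    -- `Y` kills the slices of `a_x` (transport through `G`)
    have hkill : ∀ u : Fin (2 * p) → Fin n,
        wordDerAt ℂ (fun _ : Fin (2 * p) => LinearMap.toMatrix cbσ cbσ Y) (wordSlice ax u) = 0 := by
      intro u
      have h1 := hL u
      rw [← haEq, hslice_e] at h1
      have hYG : ∀ _t : Fin (2 * p),
          LinearMap.toMatrix eC eC Y * G = G * LinearMap.toMatrix cbσ cbσ Y := fun _ => by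
        rw [hG, linearMap_toMatrix_mul_basis_toMatrix, basis_toMatrix_mul_linearMap_toMatrix]
      have h3 : wordRepAt ℂ (fun _ : Fin (2 * p) => G)
          (wordDerAt ℂ (fun _ : Fin (2 * p) => LinearMap.toMatrix cbσ cbσ Y) (wordSlice ax u)) = 0 := by
        rw [wordRepAt_wordDerAt_of_mul_eq ℂ (fun _ : Fin (2 * p) => G) hYG, h1]
      exact wordRepAt_injective ℂ (g := fun _ : Fin (2 * p) => G) (g' := fun _ : Fin (2 * p) => G')
        (funext fun _ => hG'G) (by rw [h3, map_zero])
    -- the matrix of `Y` in the block basis: the single block `[f]_{b_τ}` at place `τ`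
    have hblk : ∀ i i', LinearMap.toMatrix cbσ cbσ Y i i' = if (φ i).1 = (φ i').1 then
        (Pi.single τ (LinearMap.toMatrix (b τ) (b τ) f) :
          T → Matrix (Fin 6) (Fin 6) ℂ) (φ i').1 (φ i).2 (φ i').2 else 0 := by
      intro i i'
      rw [LinearMap.toMatrix_apply, hcbσ i']
      by_cases hk : (φ i').1 = τ
      · subst hk
        rw [Pi.single_eq_same, ← hYf]
        have hfx : (((f (b (φ i').1 (φ i').2) : _) : ℂ ⊗[ℚ] bettiCohomology A.X 1)) =
            ∑ a', LinearMap.toMatrix (b (φ i').1) (b (φ i').1) f a' (φ i').2 •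
              cbσ (φ.symm ((φ i').1, a')) := by
          conv_lhs => rw [← (b (φ i').1).sum_repr (f (b (φ i').1 (φ i').2))]
          rw [Submodule.coe_sum]
          refine Finset.sum_congr rfl fun a' _ => ?_
          rw [Submodule.coe_smul, LinearMap.toMatrix_apply, hcbσ, Equiv.apply_symm_apply]
        rw [hfx, map_sum, Finset.sum_apply']
        simp only [map_smul, Module.Basis.repr_self, Finsupp.smul_apply, Finsupp.single_apply,
          smul_eq_mul, mul_ite, mul_one, mul_zero]
        by_cases h : (φ i).1 = (φ i').1
        · rw [if_pos h, Finset.sum_eq_single (φ i).2]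
          · rw [if_pos]; rw [← h, Prod.mk.eta, Equiv.symm_apply_apply]
          · intro a' _ ha'
            rw [if_neg]
            intro hia
            apply ha'
            rw [← hia, Equiv.apply_symm_apply]
          · intro hh; exact absurd (Finset.mem_univ _) hh
        · rw [if_neg h]
          refine Finset.sum_eq_zero fun a' _ => ?_
          rw [if_neg]
          intro hia
          apply h
          rw [← hia, Equiv.apply_symm_apply]
      · rw [hY0 (φ i').1 hk _ (b (φ i').1 (φ i').2).2, map_zero, Finsupp.zero_apply]
        by_cases h : (φ i).1 = (φ i').1
        · rw [if_pos h, Pi.single_eq_of_ne hk, Matrix.zero_apply]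
        · rw [if_neg h]
    exact wordDerAt_place_eq_zero_of_blockEntries φ τ (LinearMap.toMatrix (b τ) (b τ) f) hblk hkill U

end Invariance

/-! ### §6 `B• = D• ⊗ ℂ` from real characters, Hodge–Darboux six-block bases and rational `θ`-classes -/

section Assembly

variable {A B : AbelianVariety ℂ} {n : ℕ} {g : Fin n → (B ⟶ A)}

open scoped Classical in
/-- **`Bᵖ(B) ⊆ Dᵖ(B) ⊗ ℂ` from real characters with six-dimensional blocks, Hodge–Darboux block bases and rational
symplectic classes** (the assembly, verbatim the tree's rank-four `AVSlots.hodgeClasses_divisorial_of_sp4BlockBasis`: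
the invariance theorem of §5, the passage `𝔰𝔭(V_τ) → Sp(V_τ)` place by place
(`wordRepAt_colour_eq_self_of_forall_wordDerAt_sp_eq_zero_neg`, the Gram matrix of a Hodge–Darboux basis being `−J`), the
coloured tensor FFT for `∏_τ Sp₆` with its evaluation (`wordEval_mem_divisorClassesSpan_of_forall_wordRepAt_colour_eq`;
«this algebra of invariants is generated by its elements of degree 2», Gordon p. 18) and the crossed classes
`sum_gramSixInv_smul_cup_rm6Letters_mem` fed by `hθ`). For `B` with slots over `A`: every rational `(p,p)`-class on `B`
is a `ℂ`-combination of products of `p` rational `(1,1)`-classes. [cite: Ribet1983, Thm. 1]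
[cite: Gordon1997, Thm. 6.3 (arXiv:alg-geom/9709030 p. 18)] [cite: Murty1984, §3] [cite: Hazama1989, Thm. (= Gordon 7.6.2)] -/
theorem AVSlots.hodgeClasses_divisorial_of_sp6BlockBasis [HodgeTensorFacts.{0, 0}] (hg : AVSlots A B g)
    (hHD : exists_isReal_hodgeModel) (hI : hodgePQ_independent_of_hodgeModel)
    {T : Type} [Fintype T] [DecidableEq T]
    (ψ : (BettiUniverse.hodge hHD (AbelianVariety.isSmoothProjective_holds (A := A)) 1).Polarization)
    (hself : ∀ a : (BettiUniverse.hodge hHD (AbelianVariety.isSmoothProjective_holds (A := A)) 1).endAlg,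
      LinearMap.IsAdjointPair ψ.form ψ.form (a : Module.End ℚ (bettiCohomology A.X 1))
        (a : Module.End ℚ (bettiCohomology A.X 1)))
    (σ : T → ((BettiUniverse.hodge hHD (AbelianVariety.isSmoothProjective_holds (A := A)) 1).endAlg →+* ℂ))
    (hreal : ∀ τ, (starRingEnd ℂ).comp (σ τ) = σ τ)
    (hint : DirectSum.IsInternal fun τ =>
      (BettiUniverse.hodge hHD (AbelianVariety.isSmoothProjective_holds (A := A)) 1).eigenBlock (σ τ))
    (h6 : ∀ τ, Module.finrank ℂ
      ((BettiUniverse.hodge hHD (AbelianVariety.isSmoothProjective_holds (A := A)) 1).eigenBlock (σ τ)) = 6)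
    (b : ∀ τ, Module.Basis (Fin 6) ℂ
      ((BettiUniverse.hodge hHD (AbelianVariety.isSmoothProjective_holds (A := A)) 1).eigenBlock (σ τ)))
    (hbP : ∀ τ (r : Fin 6), (r : ℕ) < 3 → (b τ r : ℂ ⊗[ℚ] bettiCohomology A.X 1) ∈
      (BettiUniverse.hodge hHD (AbelianVariety.isSmoothProjective_holds (A := A)) 1).piece 1 0)
    (hbQ : ∀ τ (r : Fin 6), 3 ≤ (r : ℕ) → (b τ r : ℂ ⊗[ℚ] bettiCohomology A.X 1) ∈
      (BettiUniverse.hodge hHD (AbelianVariety.isSmoothProjective_holds (A := A)) 1).piece 0 1)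
    (hgram : ∀ τ (a c : Fin 6), ψ.form.baseChange ℂ (b τ a : ℂ ⊗[ℚ] bettiCohomology A.X 1) (b τ c) =
      (!![0, 0, 0, 1, 0, 0; 0, 0, 0, 0, 1, 0; 0, 0, 0, 0, 0, 1; -1, 0, 0, 0, 0, 0; 0, -1, 0, 0, 0, 0;
        0, 0, -1, 0, 0, 0] : Matrix (Fin 6) (Fin 6) ℂ) a c)
    (hθ : ∀ τ, cupH1 A (b τ 0 : ℂ ⊗[ℚ] bettiCohomology A.X 1) (b τ 3) +
        cupH1 A (b τ 1 : ℂ ⊗[ℚ] bettiCohomology A.X 1) (b τ 4) +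
        cupH1 A (b τ 2 : ℂ ⊗[ℚ] bettiCohomology A.X 1) (b τ 5) ∈
      Submodule.span ℂ {c : complexBetti A.X 2 | IsRationalClass c ∧ IsOfHodgeType A.dim A.X 2 1 1 c})
    (p : ℕ) (c : complexBetti B.X (2 * p)) (hcQ : IsRationalClass c)
    (hc : IsOfHodgeType B.dim B.X (2 * p) p p c) :
    c ∈ divisorClassesSpan B.X B.dim p := by
  classical
  rcases Nat.eq_zero_or_pos p with rfl | hp
  · exact AbelianVariety.mem_divisorClassesSpan_zero B c
  haveI : Module.Finite ℚ (bettiCohomology A.X 1) := finite_bettiCohomology_one A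
  have hX : IsSmoothProjective A.dim A.X := AbelianVariety.isSmoothProjective_holds
  -- the Lie step: slices killed by `𝔰𝔭(V_τ)` at place `τ`
  set kd : Fin 6 → Fin 2 := fun r => if (r : ℕ) < 3 then 0 else 1 with hkd
  have hkd0 : ∀ τ (r : Fin 6), kd r = 0 → (b τ r : ℂ ⊗[ℚ] bettiCohomology A.X 1) ∈
      (BettiUniverse.hodge hHD hX 1).piece 1 0 := by
    intro τ r hr
    by_cases h3 : (r : ℕ) < 3
    · exact hbP τ r h3
    · rw [hkd] at hr
      simp only [h3, if_false] at hr
      exact absurd hr one_ne_zero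
  have hkd1 : ∀ τ (r : Fin 6), kd r = 1 → (b τ r : ℂ ⊗[ℚ] bettiCohomology A.X 1) ∈
      (BettiUniverse.hodge hHD hX 1).piece 0 1 := by
    intro τ r hr
    by_cases h3 : (r : ℕ) < 3
    · rw [hkd] at hr
      simp only [h3, if_true] at hr
      exact absurd hr zero_ne_one
    · exact hbQ τ r (not_lt.1 h3)
  obtain ⟨a, hca, hkill⟩ :=
    hg.exists_sp6Invariant_coeff_of_real_characters hHD hI ψ hself σ hreal hint h6 b kd hkd0 hkd1 hp hcQ hc
  rw [← hca]
  -- the Gram matrix of every block basis is `G = ( 0 I₃ ; -I₃ 0 ) = -J`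
  set G : Matrix (Fin 6) (Fin 6) ℂ := !![0, 0, 0, 1, 0, 0; 0, 0, 0, 0, 1, 0; 0, 0, 0, 0, 0, 1; -1, 0, 0, 0, 0, 0;
    0, -1, 0, 0, 0, 0; 0, 0, -1, 0, 0, 0] with hG
  have hgram' : ∀ τ, Matrix.of (fun a' c' : Fin 6 => ψ.form.baseChange ℂ (b τ a' : ℂ ⊗[ℚ] bettiCohomology A.X 1)
      (b τ c')) = G := by
    intro τ
    ext a' c'
    rw [Matrix.of_apply, hG]
    exact hgram τ a' c'
  -- the coloured `Sp`-invariance of the slices (Lie algebra → group, place by place)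
  have hinv : ∀ (U : Fin (2 * p) → Fin n × T) (τ : T)
      (g' : Matrix (Fin 6) (Fin 6) ℂ), g'ᵀ * G * g' = G →
      wordRepAt ℂ (fun q => if (Prod.snd ∘ U) q = τ then g' else 1) (wordSlice a U) = wordSlice a U := by
    intro U τ g' hg'
    rw [hG, gramSix_eq_neg_reindex_J] at hg'
    refine wordRepAt_colour_eq_self_of_forall_wordDerAt_sp_eq_zero_neg (l := Fin 3) (n := 6) finSumFinEquiv
      (Prod.snd ∘ U) τ (fun X hXsp => ?_) hg'
    rw [← gramSix_eq_neg_reindex_J, ← hG, ← hgram' τ] at hXsp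
    have hf := add_eq_zero_of_transpose_mul_gram (ψ.form.baseChange ℂ) (b τ) hXsp
    have h := hkill U τ (Matrix.toLin (b τ) (b τ) X) hf
    rw [LinearMap.toMatrix_toLin] at h
    exact h
  -- the symplectic classes and the coloured tensor FFT
  refine wordEval_mem_divisorClassesSpan_of_forall_wordRepAt_colour_eq
    (fun jr : (Fin n × T) × Fin 6 => complexBetti.map (g jr.1.1).hom.hom.hom 1
      (ofRatClassBaseChange (Motives.ComplexPoints A.X) 1 (b jr.1.2 jr.2 : ℂ ⊗[ℚ] bettiCohomology A.X 1)))
    Prod.snd (fun _ => G) (fun _ => by rw [hG]; exact gramSix_isAlt) (fun _ => by rw [hG]; exact gramSix_nondegenerate)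
    (fun s s' hss' => ?_) a hinv
  rw [hG]
  exact sum_gramSixInv_smul_cup_rm6Letters_mem g b hθ s s' hss'

/-- **`IsDivisorGenerated B`** for every abelian variety `B` with slots over an abelian variety `A` carrying the data of
`hodgeClasses_divisorial_of_sp6BlockBasis` (the tree's spelling of `B•(B) = D•(B) ⊗ ℂ`; «`Hdg(Aⁿ) = Div(Aⁿ)` for `n ≥ 1`»,
Ribet 1983 Thm. 1). [cite: Ribet1983, Thm. 1] [cite: Gordon1997, Thm. 6.3 (arXiv:alg-geom/9709030 p. 18)]
[cite: Murty1984, §3] [cite: Hazama1989, Thm. (= Gordon 7.6.2)] -/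
theorem AVSlots.isDivisorGenerated_of_sp6BlockBasis [HodgeTensorFacts.{0, 0}] (hg : AVSlots A B g)
    (hHD : exists_isReal_hodgeModel) (hI : hodgePQ_independent_of_hodgeModel)
    {T : Type} [Fintype T] [DecidableEq T]
    (ψ : (BettiUniverse.hodge hHD (AbelianVariety.isSmoothProjective_holds (A := A)) 1).Polarization)
    (hself : ∀ a : (BettiUniverse.hodge hHD (AbelianVariety.isSmoothProjective_holds (A := A)) 1).endAlg,
      LinearMap.IsAdjointPair ψ.form ψ.form (a : Module.End ℚ (bettiCohomology A.X 1))
        (a : Module.End ℚ (bettiCohomology A.X 1)))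
    (σ : T → ((BettiUniverse.hodge hHD (AbelianVariety.isSmoothProjective_holds (A := A)) 1).endAlg →+* ℂ))
    (hreal : ∀ τ, (starRingEnd ℂ).comp (σ τ) = σ τ)
    (hint : DirectSum.IsInternal fun τ =>
      (BettiUniverse.hodge hHD (AbelianVariety.isSmoothProjective_holds (A := A)) 1).eigenBlock (σ τ))
    (h6 : ∀ τ, Module.finrank ℂ
      ((BettiUniverse.hodge hHD (AbelianVariety.isSmoothProjective_holds (A := A)) 1).eigenBlock (σ τ)) = 6)
    (b : ∀ τ, Module.Basis (Fin 6) ℂ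
      ((BettiUniverse.hodge hHD (AbelianVariety.isSmoothProjective_holds (A := A)) 1).eigenBlock (σ τ)))
    (hbP : ∀ τ (r : Fin 6), (r : ℕ) < 3 → (b τ r : ℂ ⊗[ℚ] bettiCohomology A.X 1) ∈
      (BettiUniverse.hodge hHD (AbelianVariety.isSmoothProjective_holds (A := A)) 1).piece 1 0)
    (hbQ : ∀ τ (r : Fin 6), 3 ≤ (r : ℕ) → (b τ r : ℂ ⊗[ℚ] bettiCohomology A.X 1) ∈
      (BettiUniverse.hodge hHD (AbelianVariety.isSmoothProjective_holds (A := A)) 1).piece 0 1)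
    (hgram : ∀ τ (a c : Fin 6), ψ.form.baseChange ℂ (b τ a : ℂ ⊗[ℚ] bettiCohomology A.X 1) (b τ c) =
      (!![0, 0, 0, 1, 0, 0; 0, 0, 0, 0, 1, 0; 0, 0, 0, 0, 0, 1; -1, 0, 0, 0, 0, 0; 0, -1, 0, 0, 0, 0;
        0, 0, -1, 0, 0, 0] : Matrix (Fin 6) (Fin 6) ℂ) a c)
    (hθ : ∀ τ, cupH1 A (b τ 0 : ℂ ⊗[ℚ] bettiCohomology A.X 1) (b τ 3) +
        cupH1 A (b τ 1 : ℂ ⊗[ℚ] bettiCohomology A.X 1) (b τ 4) +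
        cupH1 A (b τ 2 : ℂ ⊗[ℚ] bettiCohomology A.X 1) (b τ 5) ∈
      Submodule.span ℂ {c : complexBetti A.X 2 | IsRationalClass c ∧ IsOfHodgeType A.dim A.X 2 1 1 c}) :
    IsDivisorGenerated B :=
  fun p c hcQ hc => hg.hodgeClasses_divisorial_of_sp6BlockBasis hHD hI ψ hself σ hreal hint h6 b hbP hbQ hgram hθ p c
    hcQ hc

end Assembly

end Literature.AlgebraicGeometry.HodgeTheory

end
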